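import Summits.BirchSwinnertonDyer.Rank1Residual.X11b.BDPRouteNonsingularTorsionDivisible
import Summits.BirchSwinnertonDyer.Rank1Residual.X11b.LocalPointsPrimaryComponent
import Literature.NumberTheory.EllipticCurves.BSDQuadraticDescentTorsionOddPartProofs
import HarnessLib

/-!
# Route `ErratumRoadFive`, crux 19715 `EulerHalfNotRamNoInertSetAtFive`, line `kato_Fframe` (r5.4), stub S1Λ
# `stub_katoLambdaLogBoundTamagawa` — HELPER R-C (I), part 1: `[E(K_v)[p^∞] : E₀(K_v)[p^∞]] = p^{v_p c_v}` on `E(K̄)^{I_v}`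

Seat `bsd-line-er5-p1` (LEAD g9), `--supports stmt-BirchSwinnertonDyer-19715` (helper). Theorems only: no definition, no named
fact, no instance, no notation, no `sorry`. `K : Type` (universe `0`, as X11b `LocalPointsPrimaryComponent`). No summit statement is
proved here; BSD is proved for no curve.

## What

For an elliptic curve `E` over a number field `K`, a prime `p`, a finite place `v ∤ p` (ANY reduction type), an arithmetic Frobenius
`φ ∈ D_v` at `𝔓₀` and route p2's `M₀ = nonsingularPart = E₀(K_v^{nr})^{alg} ≤ E(K̄)^{I_v}`:
**`relIndex_nonsingularPart_primary_inf_ker_eq_pow`** — `[N^{φ} : N^{φ} ⊓ M₀] = p ^ v_p(c_v)`, where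
`N^{φ} = E(K̄)^{I_v}[p^∞] ⊓ ker (φ − 1) = E(K̄)^{D_v}[p^∞]` (`inertiaSubOne_eq_zero_iff`) is the `K_v`-rational `p`-power torsion and
`c_v = [X(K_v) : X₀(K_v)]` the local Tamagawa number (`localTamagawaNumber_eq_index_nonsingularReductionSubgroup`).  This is the second
derivation `relIndex_nonsingularPrimary_ker_eq_pow` of X11b `LocalKernelTamagawaExact` (there for the tower module `B_v = E[p^∞]^{ker κ ⊓ D_v}`
with a topological generator), re-run VERBATIM for `E(K̄)^{I_v}[p^∞]` with a Frobenius: Galois descent `N^{φ} → X(K_v)`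
(`exists_point_map_eq_of_forall_map_eq`), additive and injective, with `M₀` corresponding to `X₀(K_v)` (`hasNonsingularReduction_algebraMap_iff`),
and image in `Φ_v = X(K_v)/X₀(K_v)` EXACTLY `Φ_v[p^∞]` (`exists_torsion_sub_mem_nonsingularReductionSubgroup`, torsion is algebraic
`exists_pointsMapOfEmb_eq_of_nsmul_eq_zero`), of order `p^{v_p #Φ_v}` (`natCard_primaryComponent_eq_pow_padicValNat`).
It is the Tamagawa VALUE of the local index binder (I) of the LEAD brief `Cruxes/EulerHalfNotRamNoInertSetAtFive/Lines/kato_Fframe_r5_RC_rethread_brief.md`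
(part 2, `…LocalIndex.lean`, moves it to `[𝓚_v ⊔ H¹_ur(K_v, E[p^k]) : 𝓚_v]`).

References: [GreenbergLNM1716] §3 Lemma 3.3 (p. 87), §4 proof of Thm. 4.1 (p. 74: "the index … is exactly the `p`-part `c_v^{(p)}`");
[SilvermanAEC2009] VII.§2, VII.3.1, §VII.6 (Thm. 6.1, Cor. 6.2, Prop. 6.3, Ex. 7.6), VIII.§1; [MilneADT2006] I Lemma 3.3.
-/

noncomputable section

open scoped Classical NNReal

open NumberField IsDedekindDomain Field Function WeierstrassCurve
open Literature.NumberTheory.EllipticCurves Literature.NumberTheory.EllipticCurves.GreenbergSelmer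
open Literature.NumberTheory.GaloisRepresentations
open Summit.BirchSwinnertonDyer.Rank1Residual.X11b.AcSelmer

set_option linter.dupNamespace false

namespace Summit.BirchSwinnertonDyer.BirchSwinnertonDyer.Theorems.ErratumRoadFiveKatoFframeLocalIndexCount

variable {K : Type} [Field K] [NumberField K] {W : WeierstrassCurve K} {v : HeightOneSpectrum (𝓞 K)}
  {w : Valuation (AlgebraicClosure (v.adicCompletion K)) ℝ≥0}
  (hw : ∀ x, (w x : ℝ) =
    spectralNorm (v.adicCompletion K) (AlgebraicClosure (v.adicCompletion K)) x)
  {W₀ : WeierstrassCurve w.integer}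
  (hW₀ : ((W.localMinimalIntegralModel v).map (algebraMap (v.adicCompletionIntegers K)
      (v.adicCompletion K))).baseChange (AlgebraicClosure (v.adicCompletion K)) =
    W₀.baseChange (AlgebraicClosure (v.adicCompletion K)))
  {Φ : localPoints W (v.adicCompletion K) ≃+
    (((W.localMinimalIntegralModel v).map (algebraMap (v.adicCompletionIntegers K)
      (v.adicCompletion K))).baseChange (AlgebraicClosure (v.adicCompletion K))).toAffine.Point}
  (hΦ : ∀ (σ : absoluteGaloisGroup (v.adicCompletion K)) (Q : localPoints W (v.adicCompletion K)),
    Φ (σ • Q) = Affine.Point.map ((absoluteGaloisGroup.toAlgEquiv _ σ :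
        AlgebraicClosure (v.adicCompletion K) ≃ₐ[v.adicCompletion K]
          AlgebraicClosure (v.adicCompletion K)) :
        AlgebraicClosure (v.adicCompletion K) →ₐ[v.adicCompletion K]
          AlgebraicClosure (v.adicCompletion K)) (Φ Q))
  {p : ℕ} [Fact p.Prime]

include hw hΦ in
/-- **`[E(K̄)^{D_v}[p^∞] : E(K̄)^{D_v}[p^∞] ⊓ M₀] = p^{v_p c_v(E/K)}`** at a finite `v ∤ p` (any reduction type), for an arithmetic
Frobenius `φ ∈ D_v` (`E(K̄)^{D_v}[p^∞] = E(K̄)^{I_v}[p^∞] ⊓ ker (φ − 1)`) and `M₀ = nonsingularPart` (points with non-singular reduction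
on the minimal model): Galois descent to `X(K_v)`, kernel-of-`X₀` = `M₀`, image in `Φ_v` = `Φ_v[p^∞]`. X11b `relIndex_nonsingularPrimary_ker_eq_pow`
re-run on `E(K̄)^{I_v}[p^∞]`. [cite: GreenbergLNM1716, §3 Lemma 3.3 (p. 87) and §4 proof of Thm. 4.1 (p. 74)]
[cite: SilvermanAEC2009, §VII.6 (Ex. 7.6) and VIII.§1] -/
theorem relIndex_nonsingularPart_primary_inf_ker_eq_pow [W.IsElliptic] (hpv : (p : 𝓞 K) ∉ v.asIdeal)
    {𝔐 : Ideal v.localAbsIntegers} (h𝔐 : 𝔐 ∈ v.localPrimesAbove)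
    {φ : absoluteGaloisGroup K} (hφ : IsArithFrobAt (𝓞 K) φ (adicCompletionPrime K v)) (hφD : φ ∈ decomp v) :
    (nonsingularPart W hW₀ Φ).relIndex
        (AddCommGroup.primaryComponent
            ↥(FixedPoints.addSubgroup ↥((adicCompletionPrime K v).inertia (absoluteGaloisGroup K)) W.geomPoints) p ⊓
          (inertiaSubOne W.geomPoints φ hφD).ker) =
      p ^ padicValNat p
        ((W.baseChange (v.adicCompletion K)).localTamagawaNumber (v.adicCompletionIntegers K)) := by
  have hp : (p : ℕ).Prime := Fact.out
  -- notation
  let X := (W.localMinimalIntegralModel v).map (algebraMap (v.adicCompletionIntegers K)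
    (v.adicCompletion K))
  haveI : X.IsElliptic := W.isElliptic_map_localMinimalIntegralModel (v := v)
  let Mfix := FixedPoints.addSubgroup ↥((adicCompletionPrime K v).inertia (absoluteGaloisGroup K)) W.geomPoints
  let B : AddSubgroup Mfix := AddCommGroup.primaryComponent Mfix p
  let ψ : Mfix →+ Mfix := inertiaSubOne W.geomPoints φ hφD
  let D : AddSubgroup Mfix := B ⊓ ψ.ker
  let B₀ : AddSubgroup Mfix := nonsingularPart W hW₀ Φ
  let E₀K := (W.localMinimalIntegralModel v).nonsingularReductionSubgroup
    (integers_valuationRing_valuation (v.adicCompletionIntegers K) (v.adicCompletion K))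
  let ι := closureEmb (K := K) (v.adicCompletion K)
  have hXid : X.baseChange (v.adicCompletion K) = X := by
    change X.map (algebraMap (v.adicCompletion K) (v.adicCompletion K)) = X
    rw [Algebra.algebraMap_self, WeierstrassCurve.map_id]
  -- the underlying geometric point of `P ∈ D` is `D_v`-fixed
  have hDfix : ∀ P : D, ∀ x ∈ decomp v, x • ((P : Mfix) : W.geomPoints) = ((P : Mfix) : W.geomPoints) :=
    fun P ↦ (inertiaSubOne_eq_zero_iff W hφ hφD (P : Mfix)).mp ((AddMonoidHom.mem_ker).mp P.2.2)
  have hfixD : ∀ (P : D) (σ : absoluteGaloisGroup (v.adicCompletion K)),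
      Affine.Point.map ((absoluteGaloisGroup.toAlgEquiv _ σ :
          AlgebraicClosure (v.adicCompletion K) ≃ₐ[v.adicCompletion K]
            AlgebraicClosure (v.adicCompletion K)) :
          AlgebraicClosure (v.adicCompletion K) →ₐ[v.adicCompletion K]
            AlgebraicClosure (v.adicCompletion K))
        (Φ (pointsMapOfEmb W ι ((P : Mfix) : W.geomPoints))) =
        Φ (pointsMapOfEmb W ι ((P : Mfix) : W.geomPoints)) := by
    intro P σ
    rw [← transport_pointsMapOfEmb_smul hΦ]
    congr 2
    exact hDfix P _ (resGalOfEmb_closureEmb_mem_decomp v σ)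
  -- Galois descent `d₀ : D → X(K_v)`
  have hdesc : ∀ P : D, ∃ R : (X.baseChange (v.adicCompletion K)).toAffine.Point,
      Affine.Point.map (W' := X)
        (Algebra.ofId (v.adicCompletion K) (AlgebraicClosure (v.adicCompletion K))) R =
        Φ (pointsMapOfEmb W ι ((P : Mfix) : W.geomPoints)) :=
    fun P ↦ exists_point_map_eq_of_forall_map_eq X (hfixD P)
  choose d₀ hd₀ using hdesc
  have hinj := Affine.Point.map_injective (W' := X)
    (Algebra.ofId (v.adicCompletion K) (AlgebraicClosure (v.adicCompletion K)))
  have hd₀_zero : d₀ 0 = 0 := hinj (by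
    rw [hd₀, map_zero]
    change Φ (pointsMapOfEmb W ι (((0 : D) : Mfix) : W.geomPoints)) = 0
    rw [ZeroMemClass.coe_zero, ZeroMemClass.coe_zero, map_zero, map_zero])
  have hd₀_add : ∀ P Q : D, d₀ (P + Q) = d₀ P + d₀ Q := fun P Q ↦ hinj (by
    rw [map_add, hd₀, hd₀, hd₀]
    change Φ (pointsMapOfEmb W ι ((((P : Mfix) + (Q : Mfix) : Mfix)) : W.geomPoints)) = _
    rw [AddSubgroup.coe_add, map_add, map_add])
  let d : D →+ ((W.localMinimalIntegralModel v).baseChange (v.adicCompletion K)).toAffine.Point :=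
    { toFun := fun P ↦ Affine.Point.congrEquiv hXid (d₀ P)
      map_zero' := by
        change Affine.Point.congrEquiv hXid (d₀ 0) = 0
        rw [hd₀_zero, map_zero]
      map_add' := fun P Q ↦ by
        change Affine.Point.congrEquiv hXid (d₀ (P + Q)) =
          Affine.Point.congrEquiv hXid (d₀ P) + Affine.Point.congrEquiv hXid (d₀ Q)
        rw [hd₀_add, map_add] }
  have hd : ∀ P : D, d P = Affine.Point.congrEquiv hXid (d₀ P) := fun _ ↦ rfl
  -- `d P ∈ X₀(K_v) ↔ P ∈ B₀`
  have hbridge : ∀ P : D, d P ∈ E₀K ↔ (P : Mfix) ∈ B₀ := by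
    intro P
    rw [mem_nonsingularReductionSubgroup_iff, mem_nonsingularPart_iff, hd, ← hd₀ P]
    obtain hR0 | ⟨x₀, y₀, hxy, hR⟩ : d₀ P = 0 ∨ ∃ x₀ y₀ h, d₀ P = .some x₀ y₀ h := by
      rcases d₀ P with _ | ⟨x, y, h⟩
      exacts [Or.inl rfl, Or.inr ⟨x, y, h, rfl⟩]
    · rw [hR0, map_zero, map_zero, map_zero]
      exact iff_of_true WeierstrassCurve.hasNonsingularReduction_zero
        WeierstrassCurve.hasNonsingularReduction_zero
    · rw [hR, Affine.Point.congrEquiv_some, Affine.Point.map_some, Affine.Point.congrEquiv_some]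
      exact (hasNonsingularReduction_algebraMap_iff hw (W.localMinimalIntegralModel v) h𝔐 hW₀
        _ _).symm
  -- `δ : D → Φ_v = X(K_v)/X₀(K_v)`, kernel `D ⊓ B₀`
  let δ : D →+ _ ⧸ E₀K := (QuotientAddGroup.mk' E₀K).comp d
  have hδ : ∀ P : D, δ P = QuotientAddGroup.mk (d P) := fun _ ↦ rfl
  have hker : δ.ker = B₀.addSubgroupOf D := by
    ext P
    rw [AddMonoidHom.mem_ker, AddSubgroup.mem_addSubgroupOf, hδ, QuotientAddGroup.eq_zero_iff, hbridge]
  have h1 : B₀.relIndex D = δ.ker.index := by rw [hker]; rfl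
  -- finiteness of `Φ_v`, of order `c_v`
  have hcv : (W.baseChange (v.adicCompletion K)).localTamagawaNumber (v.adicCompletionIntegers K) =
      E₀K.index := localTamagawaNumber_eq_index_nonsingularReductionSubgroup W v
  have hcv0 : (W.baseChange (v.adicCompletion K)).localTamagawaNumber (v.adicCompletionIntegers K) ≠ 0 :=
    W.localTamagawaNumber_baseChange_ne_zero v
  haveI hE₀fi : E₀K.FiniteIndex := ⟨by rw [← hcv]; exact hcv0⟩
  haveI : Finite (((W.localMinimalIntegralModel v).baseChange (v.adicCompletion K)).toAffine.Point ⧸ E₀K) :=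
    AddSubgroup.finite_quotient_of_finiteIndex
  -- the image of `δ` is the `p`-primary component of `Φ_v`
  have hrange : δ.range = AddCommGroup.primaryComponent
      (((W.localMinimalIntegralModel v).baseChange (v.adicCompletion K)).toAffine.Point ⧸ E₀K) p := by
    apply le_antisymm
    · rintro _ ⟨P, rfl⟩
      obtain ⟨k, hk⟩ := (AddCommGroup.mem_primaryComponent).mp P.2.1
      refine (AddCommGroup.mem_primaryComponent).mpr ⟨k, ?_⟩
      rw [← map_nsmul]
      have hP0 : p ^ k • P = 0 := by
        apply Subtype.ext
        rw [AddSubgroupClass.coe_nsmul, hk]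
        rfl
      rw [hP0, map_zero]
    · intro y hy
      obtain ⟨k, hk⟩ := (AddCommGroup.mem_primaryComponent).mp hy
      obtain ⟨x, rfl⟩ := QuotientAddGroup.mk_surjective y
      have hkx : p ^ k • x ∈ E₀K := by
        rw [← QuotientAddGroup.eq_zero_iff, QuotientAddGroup.mk_nsmul]; exact hk
      -- a rational `p`-power torsion point `t ≡ x`
      obtain ⟨t, ⟨s, hts⟩, htx⟩ :=
        exists_torsion_sub_mem_nonsingularReductionSubgroup W hpv x ⟨k, hkx⟩
      -- `t` comes from a `D_v`-fixed `p`-power torsion point `Pt ∈ E(K̄)`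
      set t₁ := (Affine.Point.congrEquiv hXid).symm t with ht₁
      set Q := Affine.Point.map (W' := X)
        (Algebra.ofId (v.adicCompletion K) (AlgebraicClosure (v.adicCompletion K))) t₁ with hQ
      have ht₁s : p ^ s • t₁ = 0 := by
        rw [ht₁, ← map_nsmul]
        exact (congrArg _ hts).trans (map_zero _)
      have hQs : p ^ s • Q = 0 := by rw [hQ, ← map_nsmul, ht₁s, map_zero]
      obtain ⟨Pt, hPts, hPt⟩ := exists_pointsMapOfEmb_eq_of_nsmul_eq_zero W ι
        (pow_ne_zero s hp.ne_zero) (Q := Φ.symm Q) (by rw [← map_nsmul, hQs, map_zero])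
      have hΦPt : Φ (pointsMapOfEmb W ι Pt) = Q := by rw [hPt, AddEquiv.apply_symm_apply]
      have hPtfix : ∀ x ∈ decomp v, x • Pt = Pt := by
        intro x hx
        obtain ⟨σ, rfl⟩ := exists_eq_resGalOfEmb_of_mem_decomp v hx
        apply pointsMapOfEmb_injective W ι
        apply Φ.injective
        rw [transport_pointsMapOfEmb_smul hΦ, hΦPt, hQ]
        exact map_toAlgEquiv_map_ofId X t₁ σ
      -- `Pt` as an element of `E(K̄)^{I_v}` (`I_v ≤ D_v`), `p`-power torsion, in `ker (φ − 1)`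
      let bP : Mfix := ⟨Pt, fun i ↦ hPtfix _ (inertia_adicCompletionPrime_le_decomp v i.2)⟩
      have hbPB : bP ∈ B := (AddCommGroup.mem_primaryComponent).mpr ⟨s, Subtype.ext (by
        rw [AddSubgroupClass.coe_nsmul, ZeroMemClass.coe_zero]; exact hPts)⟩
      have hbPker : bP ∈ ψ.ker := (AddMonoidHom.mem_ker).mpr ((inertiaSubOne_eq_zero_iff W hφ hφD bP).mpr hPtfix)
      have hbP : bP ∈ D := ⟨hbPB, hbPker⟩
      refine ⟨⟨bP, hbP⟩, ?_⟩
      -- `d ⟨bP⟩ = t`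
      have hdt : d ⟨bP, hbP⟩ = t := by
        rw [hd]
        have : d₀ ⟨bP, hbP⟩ = t₁ := hinj (by
          rw [hd₀]
          change Φ (pointsMapOfEmb W ι Pt) = _
          rw [hΦPt, hQ])
        rw [this, ht₁, AddEquiv.apply_symm_apply]
      rw [hδ, hdt, QuotientAddGroup.eq_iff_sub_mem]
      exact htx
  -- count
  rw [h1, AddSubgroup.index_ker, hrange, natCard_primaryComponent_eq_pow_padicValNat p, hcv,
    AddSubgroup.index_eq_card]

end Summit.BirchSwinnertonDyer.BirchSwinnertonDyer.Theorems.ErratumRoadFiveKatoFframeLocalIndexCount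

end
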